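import Summits.CriticalPhenomena.SAWScalingLimit.Theses.SAWConePseudogroup
import Summits.CriticalPhenomena.SAWScalingLimit.Theorems.SAWConePseudogroupLatticeSimilarityOfLimitTransport
import Literature.Probability.RandomPlanarGeometry.SAWScalingLimitFamily
import Literature.Probability.RandomPlanarGeometry.ConformalRestrictionProofs
import Literature.Probability.RandomPlanarGeometry.ZoomFlow
import HarnessLib

/-!
# `LatticeSimilarityOfLimit` (item stmt-CriticalPhenomena-7306, route SAWConePseudogroup)

**Every full scaling limit of the critical `δℤ²` self-avoiding walk is covariant under the lattice
similarities `z ↦ r·iᵏ·z + w` (`r > 0`, `k ∈ ℕ`, `w ∈ ℂ`).**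

Let `P : DobrushinDomain → Measure (CurveClass ℂ)` be chordal and the weak limit, for EVERY Dobrushin
domain and EVERY endpoint approximation, of the critical SAW laws `SAW.law` pushed to curves
(`SAW.IsScalingLimitFamily P`, literally the two hypotheses of the item). The proof is the classical
"exact lattice symmetry + uniqueness of weak limits" bookkeeping (Lawler–Schramm–Werner 2004, §3.4.2;
Billingsley 1999, Thm 1.2), organised as follows.

* `apply_eq_map_of_latticeIdentity` — **identification principle**: if along positive sequences
  `δₙ → 0`, `εₙ → 0` the critical SAW law of `D'` at mesh `δₙ` (endpoint approximation `a', b'`),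
  pushed to curves, IS the push-forward along a continuous plane map `g` of the critical SAW law of
  `D` at mesh `εₙ` (endpoint approximation `a, b`), then `P D' = g_* (P D)`: both sides are limits of
  the same real sequences of test integrals (`tendsto_nhds_unique`), and finite Borel measures on the
  metric space `CurveClass ℂ` are determined by bounded continuous integrals
  (`ext_of_forall_integral_eq_of_IsFiniteMeasure`).
* Quarter turn `z ↦ i z`: the lattice identity at every mesh and the rotated endpoint approximation
  are the tree's `stub_quarterTurnCovariance` (Theorems file
  `SAWDevelopingMapHexTransferQuarterTurnCovariance`).
* Dilation `z ↦ r z`, `r > 0`, and axis-parallel translations `z ↦ z + t`, `z ↦ z + i t`: the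
  mesh-by-mesh identities and endpoint approximations of the helper file
  `SAWConePseudogroupLatticeSimilarityOfLimitTransport.lean` (`(rΩ)_δ = Ω_{δ/r}`; `t = δₙ kₙ` is a
  lattice vector along the meshes `δₙ = |t|/(n+1)`, `exists_mesh_seq`, with spliced endpoint
  approximations).
* Composition: `similarity (r iᵏ) _ w = (quarter turn)ᵏ ≫ (dilation r) ≫ (+ re w) ≫ (+ i im w)` and
  covariances compose (`ChordalFamily.covariant_trans`, `LatticeSimilarityCovariance.lean`).

The hypothesis "every Dobrushin domain admits an endpoint approximation" of the item is not needed
(it is the tree's theorem `SAW.exists_isEndpointApprox`) but is of course accepted.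

References: G. F. Lawler, O. Schramm, W. Werner, *On the scaling limit of planar self-avoiding
walk* (2004), §3.4.2; V. Beffara, *Is critical 2D percolation universal?* (2008), §2.2;
P. Billingsley, *Convergence of probability measures*, 2nd ed. (1999), Thm 1.2. All [folklore].
-/

noncomputable section

open MeasureTheory Filter Topology Set
open Literature.Probability.LatticeModels Literature.Probability.RandomPlanarGeometry
open Summit.CriticalPhenomena.SAWScalingLimit.Cruxes.HexTransfer.PinTheShear
  (stub_quarterTurnCovariance)

namespace Summit.CriticalPhenomena.SAWScalingLimit.Theorems.LatticeSimilarityOfLimit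

/-! ### Identification principle: a lattice identity along a sequence identifies the limit -/

section Identification

variable {P : ChordalFamily}

/-- **Identification principle** (uniqueness of weak limits, Billingsley Thm 1.2). Let `P` be a
scaling-limit family of the critical SAW. If along positive sequences `εₙ → 0`, `δₙ → 0` the
critical SAW law of `D` at mesh `εₙ` (endpoints `a, b`), pushed to curves and then along the
continuous plane map `g`, equals the critical SAW law of `D'` at mesh `δₙ` (endpoints `a', b'`)
pushed to curves, for endpoint approximations `(a, b)` of `D` and `(a', b')` of `D'`, then
`P D' = g_* (P D)`. [folklore] -/
theorem apply_eq_map_of_latticeIdentity (hP : SAW.IsScalingLimitFamily P) (g : C(ℂ, ℂ))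
    {D D' : DobrushinDomain} {a b a' b' : ℝ → Site 2} (hab : SAW.IsEndpointApprox D a b)
    (hab' : SAW.IsEndpointApprox D' a' b') {δs εs : ℕ → ℝ} (hδ : ∀ n, 0 < δs n)
    (hδ0 : Tendsto δs atTop (𝓝 0)) (hε : ∀ n, 0 < εs n) (hε0 : Tendsto εs atTop (𝓝 0))
    (hid : ∀ n, ((SAW.law D.carrier (εs n) (a (εs n)) (b (εs n))).map (fun γ => γ.curve)).map
        (CurveClass.map g) =
      (SAW.law D'.carrier (δs n) (a' (δs n)) (b' (δs n))).map (fun γ => γ.curve)) :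
    P D' = (P D).map (CurveClass.map g) := by
  haveI := hP.isProbabilityMeasure D
  haveI := hP.isProbabilityMeasure D'
  refine ext_of_forall_integral_eq_of_IsFiniteMeasure fun f => ?_
  have hδ' : Tendsto δs atTop (𝓝[>] (0 : ℝ)) :=
    tendsto_nhdsWithin_iff.2 ⟨hδ0, Eventually.of_forall hδ⟩
  have hε' : Tendsto εs atTop (𝓝[>] (0 : ℝ)) :=
    tendsto_nhdsWithin_iff.2 ⟨hε0, Eventually.of_forall hε⟩
  have h1 := (hP.tendstoLaw hab' f).comp hδ'
  have h2 := (hP.tendstoLaw hab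
    (f.compContinuous ⟨CurveClass.map g, CurveClass.continuous_map g⟩)).comp hε'
  simp only [id, BoundedContinuousFunction.compContinuous_apply, ContinuousMap.coe_mk] at h1 h2
  rw [integral_map (CurveClass.measurable_map g).aemeasurable f.continuous.aestronglyMeasurable]
  refine tendsto_nhds_unique (h1.congr fun n => ?_) h2
  simp only [Function.comp_apply]
  rw [← integral_map (SAW.DomainSAW.measurable_of_top _).aemeasurable
      f.continuous.aestronglyMeasurable, ← hid n,
    Measure.map_map (CurveClass.measurable_map g) (SAW.DomainSAW.measurable_of_top _),
    integral_map ((CurveClass.measurable_map g).comp (SAW.DomainSAW.measurable_of_top _)).aemeasurable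
      f.continuous.aestronglyMeasurable]
  rfl

/-- **Quarter-turn covariance of the limit** (`stub_quarterTurnCovariance` at every mesh and the
identification principle). [folklore] -/
theorem cov_mul_I (hP : SAW.IsScalingLimitFamily P) (D : DobrushinDomain) :
    P (D.map (similarity Complex.I Complex.I_ne_zero 0)) =
      (P D).map (CurveClass.map (similarity Complex.I Complex.I_ne_zero 0 : C(ℂ, ℂ))) := by
  obtain ⟨a, b, hab⟩ := SAW.exists_isEndpointApprox D
  exact apply_eq_map_of_latticeIdentity hP _ hab (stub_quarterTurnCovariance.2 D a b hab)
    (fun _ => Nat.one_div_pos_of_nat) tendsto_one_div_add_atTop_nhds_zero_nat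
    (fun _ => Nat.one_div_pos_of_nat) tendsto_one_div_add_atTop_nhds_zero_nat fun n =>
    stub_quarterTurnCovariance.1 D.carrier _ (a _) (b _)

/-- **Dilation covariance of the limit** (`(rΩ)_δ = Ω_{δ/r}` and the identification principle with
`εₙ = δₙ / r`). [folklore] -/
theorem cov_dilate (hP : SAW.IsScalingLimitFamily P) {r : ℝ} (hr : 0 < r) (hr' : (r : ℂ) ≠ 0)
    (D : DobrushinDomain) :
    P (D.map (similarity r hr' 0)) =
      (P D).map (CurveClass.map (similarity r hr' 0 : C(ℂ, ℂ))) := by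
  obtain ⟨a, b, hab⟩ := SAW.exists_isEndpointApprox D
  refine apply_eq_map_of_latticeIdentity hP _ hab (isEndpointApprox_dilate hr hr' hab)
    (εs := fun n => 1 / ((n : ℝ) + 1) / r) (fun _ => Nat.one_div_pos_of_nat)
    tendsto_one_div_add_atTop_nhds_zero_nat (fun n => div_pos Nat.one_div_pos_of_nat hr) ?_
    fun n => map_curve_law_dilate hr hr' D.carrier _ _ _
  simpa using (tendsto_one_div_add_atTop_nhds_zero_nat (𝕜 := ℝ)).div_const r

/-- **Translation covariance of the limit along a lattice direction**: if `w` is a lattice vector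
`δₙ vₙ` along positive meshes `δₙ → 0`, then `P (w + D) = (· + w)_* (P D)` (spliced endpoint
approximation, exact covariance at the meshes `δₙ`, identification principle). [folklore] -/
theorem cov_translate (hP : SAW.IsScalingLimitFamily P) (w : ℂ) {δs : ℕ → ℝ} {vs : ℕ → Site 2}
    (hδ : ∀ n, 0 < δs n) (hδ0 : Tendsto δs atTop (𝓝 0)) (hv : ∀ n, meshPoint (δs n) (vs n) = w)
    (D : DobrushinDomain) :
    P (D.map (similarity 1 one_ne_zero w)) =
      (P D).map (CurveClass.map (similarity 1 one_ne_zero w : C(ℂ, ℂ))) := by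
  classical
  obtain ⟨a, b, hab⟩ := SAW.exists_isEndpointApprox D
  obtain ⟨a₀, b₀, h₀⟩ := SAW.exists_isEndpointApprox (D.map (similarity 1 one_ne_zero w))
  -- the lattice vector representing `w` at mesh `δ`, when there is one
  set v : ℝ → Site 2 := fun δ => if h : ∃ u : Site 2, meshPoint δ u = w then h.choose else 0
    with hv_def
  have hp : ∀ δ, (∃ u : Site 2, meshPoint δ u = w) → meshPoint δ (v δ) = w := fun δ h => by
    simp only [hv_def, dif_pos h]
    exact h.choose_spec
  have happ := isEndpointApprox_splice w hab h₀ v (fun δ => ∃ u : Site 2, meshPoint δ u = w) hp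
  refine apply_eq_map_of_latticeIdentity hP _ hab happ hδ hδ0 hδ hδ0 fun n => ?_
  have hn : ∃ u : Site 2, meshPoint (δs n) u = w := ⟨vs n, hv n⟩
  exact (map_curve_law_translate D.carrier (δs n) (v (δs n)) (hp _ hn) _ _).trans
    (map_curve_law_congr (if_pos hn).symm (if_pos hn).symm)

/-- Real axis translations `t ∈ ℝ` are lattice vectors along suitable meshes: `t = δₙ kₙ` with
`δₙ > 0`, `δₙ → 0`, `kₙ ∈ ℤ`. [folklore] -/
theorem exists_mesh_seq (t : ℝ) :
    ∃ (δs : ℕ → ℝ) (k : ℕ → ℤ), (∀ n, 0 < δs n) ∧ Tendsto δs atTop (𝓝 0) ∧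
      ∀ n, δs n * k n = t := by
  rcases lt_trichotomy t 0 with ht | rt | ht
  · refine ⟨fun n => -t / ((n : ℝ) + 1), fun n => -((n : ℤ) + 1),
      fun n => div_pos (by linarith) (by positivity), ?_, fun n => ?_⟩
    · have h := (tendsto_one_div_add_atTop_nhds_zero_nat (𝕜 := ℝ)).const_mul (-t)
      rw [mul_zero] at h
      exact Tendsto.congr (fun n => by ring) h
    · push_cast
      field_simp
  · subst rt
    exact ⟨fun n => 1 / ((n : ℝ) + 1), fun _ => 0, fun _ => Nat.one_div_pos_of_nat,
      tendsto_one_div_add_atTop_nhds_zero_nat, fun n => by simp⟩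
  · refine ⟨fun n => t / ((n : ℝ) + 1), fun n => (n : ℤ) + 1, fun n => by positivity, ?_,
      fun n => ?_⟩
    · have h := (tendsto_one_div_add_atTop_nhds_zero_nat (𝕜 := ℝ)).const_mul t
      rw [mul_zero] at h
      exact Tendsto.congr (fun n => by ring) h
    · push_cast
      field_simp

/-- Translation covariance of the limit under real translations `z ↦ z + t`. [folklore] -/
theorem cov_translate_ofReal (hP : SAW.IsScalingLimitFamily P) (t : ℝ) (D : DobrushinDomain) :
    P (D.map (similarity 1 one_ne_zero (t : ℂ))) =
      (P D).map (CurveClass.map (similarity 1 one_ne_zero (t : ℂ) : C(ℂ, ℂ))) := by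
  obtain ⟨δs, k, hδ, hδ0, hk⟩ := exists_mesh_seq t
  refine cov_translate hP _ hδ hδ0 (vs := fun n => ![k n, 0]) (fun n => ?_) D
  apply Complex.ext
  · simp [← hk n]
  · simp

/-- Translation covariance of the limit under imaginary translations `z ↦ z + i t`. [folklore] -/
theorem cov_translate_mul_I (hP : SAW.IsScalingLimitFamily P) (t : ℝ) (D : DobrushinDomain) :
    P (D.map (similarity 1 one_ne_zero ((t : ℂ) * Complex.I))) =
      (P D).map (CurveClass.map (similarity 1 one_ne_zero ((t : ℂ) * Complex.I) : C(ℂ, ℂ))) := by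
  obtain ⟨δs, k, hδ, hδ0, hk⟩ := exists_mesh_seq t
  refine cov_translate hP _ hδ hδ0 (vs := fun n => ![0, k n]) (fun n => ?_) D
  apply Complex.ext
  · simp
  · simp [← hk n]

end Identification

/-! ### Composition and the item -/

section Assembly

variable {P : ChordalFamily}

/-- Covariance under the iterated quarter turns `z ↦ iᵏ z`. [folklore] -/
theorem cov_I_pow (hP : SAW.IsScalingLimitFamily P) (k : ℕ) (hk : Complex.I ^ k ≠ 0)
    (D : DobrushinDomain) :
    P (D.map (similarity (Complex.I ^ k) hk 0)) =
      (P D).map (CurveClass.map (similarity (Complex.I ^ k) hk 0 : C(ℂ, ℂ))) := by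
  induction k generalizing D with
  | zero =>
    have h1 : similarity (Complex.I ^ 0) hk 0 = Homeomorph.refl ℂ := by
      ext z
      simp
    rw [h1, MarkedDomain.map_refl, CurveClass.map_homeomorph_refl, Measure.map_id]
  | succ k ih =>
    have hk' : Complex.I ^ k ≠ 0 := pow_ne_zero _ Complex.I_ne_zero
    have h1 : similarity (Complex.I ^ (k + 1)) hk 0 =
        (similarity (Complex.I ^ k) hk' 0).trans (similarity Complex.I Complex.I_ne_zero 0) := by
      rw [similarity_trans_similarity]
      exact similarity_congr _ _ (pow_succ' _ _)
    rw [h1]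
    exact ChordalFamily.covariant_trans (measurable_curveClassMap_similarity _ _ _)
      (measurable_curveClassMap_similarity _ _ _) (ih hk') (cov_mul_I hP) D

/-- **Lattice-similarity covariance of a scaling-limit family**: `P (φ D) = φ_* (P D)` for every
`φ : z ↦ c z + w` with `c = r iᵏ`, `r > 0`. [folklore] -/
theorem cov_similarity (hP : SAW.IsScalingLimitFamily P) (D : DobrushinDomain) (c : ℂ) (hc : c ≠ 0)
    (w : ℂ) (hcm : ∃ (r : ℝ) (k : ℕ), 0 < r ∧ c = (r : ℂ) * Complex.I ^ k) :
    P (D.map (similarity c hc w)) = (P D).map (CurveClass.map (similarity c hc w : C(ℂ, ℂ))) := by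
  obtain ⟨r, k, hr, rfl⟩ := hcm
  have hr' : (r : ℂ) ≠ 0 := Complex.ofReal_ne_zero.2 hr.ne'
  have hk : Complex.I ^ k ≠ 0 := pow_ne_zero _ Complex.I_ne_zero
  have key : similarity ((r : ℂ) * Complex.I ^ k) hc w =
      (((similarity (Complex.I ^ k) hk 0).trans (similarity r hr' 0)).trans
        (similarity 1 one_ne_zero (w.re : ℂ))).trans
        (similarity 1 one_ne_zero ((w.im : ℂ) * Complex.I)) := by
    ext1 z
    simp only [Homeomorph.trans_apply, similarity_apply, add_zero, one_mul]
    rw [add_assoc, Complex.re_add_im, mul_assoc]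
  rw [key]
  refine ChordalFamily.covariant_trans (CurveClass.measurable_map _)
    (measurable_curveClassMap_similarity _ _ _) (fun D => ?_) (cov_translate_mul_I hP w.im) D
  refine ChordalFamily.covariant_trans (CurveClass.measurable_map _)
    (measurable_curveClassMap_similarity _ _ _) (fun D => ?_) (cov_translate_ofReal hP w.re) D
  exact ChordalFamily.covariant_trans (measurable_curveClassMap_similarity _ _ _)
    (measurable_curveClassMap_similarity _ _ _) (cov_I_pow hP k hk) (cov_dilate hP hr hr') D

end Assembly

end Summit.CriticalPhenomena.SAWScalingLimit.Theorems.LatticeSimilarityOfLimit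

namespace Summit.CriticalPhenomena.SAWScalingLimit.Theorems

open LatticeSimilarityOfLimit

/-- **Item stmt-CriticalPhenomena-7306 (`LatticeSimilarityOfLimit`, route SAWConePseudogroup).**
Every chordal full scaling limit `P` of the critical `δℤ²` SAW laws (weak limit for every Dobrushin
domain and every endpoint approximation) is covariant under the lattice similarities
`z ↦ r·iᵏ·z + w` (`r > 0`, `k ∈ ℕ`, `w ∈ ℂ`): quarter turns are exact at each mesh, dilations via
`(λΩ)_δ = λ·Ω_{δ/λ}`, axis-parallel translations are exact along `δₙ = |w|/(n+1)` with spliced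
endpoint approximations; then compose (`cov_similarity`). [folklore] -/
theorem latticeSimilarityOfLimit_proof :
    Summit.CriticalPhenomena.SAWScalingLimit.Theses.SAWConePseudogroup.LatticeSimilarityOfLimit := by
  intro _ P hch hlim D c hc w hcm
  exact cov_similarity ⟨hch, hlim⟩ D c hc w hcm

end Summit.CriticalPhenomena.SAWScalingLimit.Theorems

end
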